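import Summits.CriticalPhenomena.PercolationContinuityZ3.Theorems.PercNearOneGluingNoHeavyQuantFarSunLargeKCentral
import Summits.CriticalPhenomena.PercolationContinuityZ3.Theorems.PercNearOneGluingNoHeavyQuantFarSunAllLayersK
import HarnessLib

/-!
# FAR beyond trees: **EVERY LAYER OF FAR HOLDS ON ALL LONG HAIRY CYCLES** — for every layer `j ≥ 2` and every `K` with
# `(64·2^j + 2)² ≤ j·K`:  `HairyCycle.SunFAR K j`  (unconditional; the first all-layer infinite family beyond `K ≤ 11`)

builds on p205010 (kernel theorem, internal audit signed; external expert review pending)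

Support file (`--supports stmt-CriticalPhenomena-4575`), seat `prim-cert-1` (gen 41); memo `prim-cert-1/FROM-prim-cert-1-g41-ALL-LAYERS.md` §3.
The every-layer conditional assembly `HairyCycle.sunFAR_of_witGavg_from_all` (…QuantFarSunAllLayersK: THM A = universal-witness certificate with
the averaged kernel, THM B at every layer) asks, for `K ≥ K₁`, only for `witGavg K h j ≥ 1` on the region `R_j = {j(F − η) < η(Σ − 2j)}`
(`Σ = Σ h > 2j`, `η` the least weight, `F = P(T ≥ j+1)`).  Here, with CRUDE explicit constants (the layer-two files of gen 37 have `Σ ≥ 14`, `K ≥ 85`):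
* LEMMA 2_j (`HairyCycle.jK_lt_of_R`): on `R_j`, `j·K < (Σ+1)²` and `η > 0` — from the NBU lower bound `F ≥ (Σ − j)/(Σ + 1)`
  (`Quant.CountDP.mean_sub_le_tail_mul`: `E − j ≤ P(S ≥ j+1)(E + 1)` by `Quant.CountDP.tail_nbu`) and `η ≤ Σ/K`;
* LEMMA 1_j (`HairyCycle.witGavg_ge_one_largeK`): `0 < h ≤ 1`, `Σ ≥ 64·2^j` and `j·K < (Σ+1)²` give `witGavg K h j ≥ 1` — the charging criterion
  (`HairyCycle.witGavg_ge_one_of_charging`) with unit weights on the `2j`-central positions (more than `Σ − 4j − 2` of them, `card_central_gt_gen`),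
  the boost bound `a_k ≥ (1 − h_k)/(4K)` (`boost_ge_quarter_div`), the no-witness bound `d_k ≤ (1 − h_k)·P(T ≤ 2j+1)` (`noWit_erase_le_gen`), the Chernoff
  bound `P(T ≤ 2j+1) ≤ 2^{2j+1}e^{−Σ/2}` and the numeric inequality `4(Σ+1)²·2^{2j+1}e^{−Σ/2} ≤ j(Σ − 6j − 2)` for `Σ ≥ 64·2^j` (`e^{x} ≥ x⁴/24`);
* **`HairyCycle.sunFAR_of_largeK`** — for `j ≥ 2` and `(64·2^j + 2)² ≤ j·K`:  `SunFAR K j`.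
So at every layer only finitely many `K` remain open (`12 ≤ K < (64·2^j+2)²/j`; constants far from optimal, memo §2).  No definitions, no sorries,
standard axioms.  [this work]
[cite: KozmaNitzan2024, Conjecture 3 (p. 15)] (context: the lower-tail family FAR serves).
-/

noncomputable section

namespace Summit.CriticalPhenomena.PercolationContinuityZ3.Theorems

namespace Quant

namespace CountDP

open Finset

/-- `PB[p, m] b` = probability that exactly `b` of the first `m` independent trials succeed (recursion on `m`, as in `…QuantCountDP.lean`). -/
local notation3 "PB[" p ", " m "]" =>
  (Nat.rec (motive := fun _ => ℕ → ℝ) (fun b => if b = 0 then (1 : ℝ) else 0)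
    (fun n f b => (p : ℕ → ℝ) n * (if b = 0 then (0 : ℝ) else f (b - 1)) + (1 - (p : ℕ → ℝ) n) * f b) (m : ℕ))

variable (p : ℕ → ℝ)

/-- **NBU lower bound for the upper tail**: `Σ_{k<m} p k − j ≤ P(S_m ≥ j+1)·(Σ_{k<m} p k + 1)` (`p ∈ [0,1]`):
`E = Σ_{a<m} P(S ≥ a+1) ≤ j + Σ_{t} P(S ≥ j+1+t) ≤ j + P(S ≥ j+1)·(1 + E)` by NBU. [this work] -/
theorem mean_sub_le_tail_mul (hp : ∀ k, 0 ≤ p k ∧ p k ≤ 1) (m j : ℕ) :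
    ∑ k ∈ Finset.range m, p k - j ≤
      (1 - ∑ i ∈ Finset.range (j + 1), PB[p, m] i) * (∑ k ∈ Finset.range m, p k + 1) := by
  set E := ∑ k ∈ Finset.range m, p k with hEdef
  set t : ℕ → ℝ := fun a => 1 - ∑ i ∈ Finset.range a, PB[p, m] i with htdef
  have ht0 : ∀ a, 0 ≤ t a := fun a => by rw [htdef]; linarith [cdf_le_one p hp m a]
  have hE0 : 0 ≤ E := Finset.sum_nonneg fun k _ => (hp k).1
  have hmean : ∑ a ∈ Finset.range m, t (a + 1) = E := by rw [htdef, hEdef, ← sum_tail_eq_mean p m]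
  rcases Nat.lt_or_ge m (j + 1) with hmj | hmj
  · -- `m ≤ j`: `E ≤ m ≤ j`
    have hEm : E ≤ m := by
      rw [hEdef]
      have := Finset.sum_le_sum (s := Finset.range m) (f := p) (g := fun _ => (1 : ℝ)) fun k _ => (hp k).2
      simpa using this
    have hmj' : (m : ℝ) ≤ j := by exact_mod_cast (show m ≤ j by omega)
    have := mul_nonneg (ht0 (j + 1)) (show 0 ≤ E + 1 by linarith)
    change E - j ≤ t (j + 1) * (E + 1)
    linarith
  · obtain ⟨n, rfl⟩ : ∃ n, m = j + n := ⟨m - j, by omega⟩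
    -- split the tail sum at `j`
    have hsplit : ∑ a ∈ Finset.range (j + n), t (a + 1) = ∑ a ∈ Finset.range j, t (a + 1) + ∑ a ∈ Finset.range n, t (j + a + 1) :=
      Finset.sum_range_add _ _ _
    have h1 : ∑ a ∈ Finset.range j, t (a + 1) ≤ j := by
      have := Finset.sum_le_sum (s := Finset.range j) (f := fun a => t (a + 1)) (g := fun _ => (1 : ℝ)) fun a _ => by
        change 1 - ∑ i ∈ Finset.range (a + 1), PB[p, j + n] i ≤ 1
        linarith [cdf_nonneg p hp (j + n) (a + 1)]
      simpa using this
    -- NBU: `t (j+1+a) ≤ t (j+1) · t a`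
    have h2 : ∑ a ∈ Finset.range n, t (j + a + 1) ≤ t (j + 1) * ∑ a ∈ Finset.range n, t a := by
      rw [Finset.mul_sum]
      refine Finset.sum_le_sum fun a _ => ?_
      have := tail_nbu p hp (j + n) (j + 1) a
      rw [show j + 1 + a = j + a + 1 by ring] at this
      exact this
    -- `Σ_{a<n} t a ≤ 1 + E`
    have h3 : ∑ a ∈ Finset.range n, t a ≤ 1 + E := by
      cases n with
      | zero => simp; linarith
      | succ n =>
        rw [Finset.sum_range_succ']
        have e0 : t 0 = 1 := by simp [htdef]
        have h4 : ∑ a ∈ Finset.range n, t (a + 1) ≤ ∑ a ∈ Finset.range (j + (n + 1)), t (a + 1) :=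
          Finset.sum_le_sum_of_subset_of_nonneg (Finset.range_mono (by omega)) fun a _ _ => ht0 (a + 1)
        rw [hmean] at h4
        linarith
    have h5 : t (j + 1) * ∑ a ∈ Finset.range n, t a ≤ t (j + 1) * (1 + E) := mul_le_mul_of_nonneg_left h3 (ht0 (j + 1))
    have hE : E = ∑ a ∈ Finset.range j, t (a + 1) + ∑ a ∈ Finset.range n, t (j + a + 1) := by rw [← hmean, hsplit]
    change E - j ≤ t (j + 1) * (E + 1)
    have h6 := h2.trans h5
    linarith

end CountDP

end Quant

namespace HairyCycle

open Finset
open scoped Classical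

variable {K : ℕ}

/-! ## LEMMA 2 at every layer -/

/-- **NBU lower bound for `F`**: `Σ_{k<K} h k − j ≤ hairV K h j (range K)·(Σ_{k<K} h k + 1)` (`h ∈ [0,1]` everywhere). [this work] -/
theorem sum_sub_le_hairV_univ_mul {h : ℕ → ℝ} (hh : ∀ k, 0 ≤ h k ∧ h k ≤ 1) (j : ℕ) :
    ∑ k ∈ range K, h k - j ≤ hairV K h j (range K) * (∑ k ∈ range K, h k + 1) := by
  have hb := hairV_eq_one_sub_cdf (K := K) h j (range K)
  have hs := Quant.CountDP.mean_sub_le_tail_mul (fun i => h (Nat.nth (· ∈ range K) i)) (nth_trials_mem hh (range K))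
    (Nat.count (· ∈ range K) K) j
  rw [sum_nth_trials_eq (subset_refl _) h] at hs
  rw [hb]
  simpa using hs

/-- **LEMMA 2 at layer `j ≥ 1`.**  Let `h ∈ [0,1]` (everywhere), `m < K` with `h m ≤ h k` (`k < K`), `Σ := Σ_{k<K} h k > 2j` and the regime
`R_j`: `j·(F − h m) < h m·(Σ − 2j)` (`F = hairV K h j (range K)`).  Then `j·K < (Σ + 1)²` and `0 < h m`. [this work] -/
theorem jK_lt_of_R {h : ℕ → ℝ} (hh : ∀ k, 0 ≤ h k ∧ h k ≤ 1) {j : ℕ} (hj : 1 ≤ j) {m : ℕ} (hm : m < K)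
    (hmin : ∀ k, k < K → h m ≤ h k) (hSig : (2 * j : ℝ) < ∑ k ∈ range K, h k)
    (hR : j * (hairV K h j (range K) - h m) < h m * (∑ k ∈ range K, h k - 2 * j)) :
    (j : ℝ) * K < (∑ k ∈ range K, h k + 1) ^ 2 ∧ 0 < h m := by
  set S := ∑ k ∈ range K, h k with hSdef
  set F := hairV K h j (range K) with hFdef
  set η := h m with hηdef
  have hF0 : 0 ≤ F := hairV_nonneg' (fun k _ => hh k) j (range K)
  have hj1 : (1 : ℝ) ≤ j := by exact_mod_cast hj
  have hη0 : 0 ≤ η := (hh m).1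
  have hηpos : 0 < η := by
    by_contra hneg
    have hz : η = 0 := le_antisymm (le_of_not_gt hneg) hη0
    rw [hz] at hR
    nlinarith
  refine ⟨?_, hηpos⟩
  -- `η·K ≤ S`
  have hηK : η * K ≤ S := by
    have := Finset.sum_le_sum (s := range K) (f := fun _ => η) (g := h) fun k hk => hmin k (Finset.mem_range.1 hk)
    rw [Finset.sum_const, Finset.card_range, nsmul_eq_mul] at this
    rw [hSdef]; linarith
  -- NBU: `S − j ≤ F(S+1)`; `R_j`: `jF < η(S − j)`
  have hnbu := sum_sub_le_hairV_univ_mul hh (K := K) j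
  rw [← hSdef, ← hFdef] at hnbu
  have hjF : (j : ℝ) * F < η * (S - j) := by nlinarith
  have hSj : 0 < S - j := by linarith
  -- `j(S − j) ≤ jF(S+1) < η(S−j)(S+1)` ⟹ `j < η(S+1)` ⟹ `jK < ηK(S+1) ≤ S(S+1) < (S+1)²`
  have h1a : (j : ℝ) * (S - j) ≤ (j : ℝ) * F * (S + 1) := by nlinarith
  have h1b : (j : ℝ) * F * (S + 1) < η * (S - j) * (S + 1) := by nlinarith
  have h1 : (j : ℝ) * (S - j) < η * (S + 1) * (S - j) := by linarith
  have h2 : (j : ℝ) < η * (S + 1) := lt_of_mul_lt_mul_right h1 hSj.le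
  have hK0 : (0 : ℝ) < K := by exact_mod_cast (show 0 < K by omega)
  have h3 : (j : ℝ) * K < η * (S + 1) * K := mul_lt_mul_of_pos_right h2 hK0
  have h4 : η * (S + 1) * K ≤ S * (S + 1) := by nlinarith
  nlinarith

/-- **Numeric core**: for `1 ≤ j` and `64·2^j ≤ S`:  `4(S+1)²·2^{2j+1}·e^{−S/2} ≤ j·(S − 6j − 2)` (via `e^{S/2} ≥ (S/2)⁴/24`). [this work] -/
theorem largeK_numeric {j : ℕ} (hj : 1 ≤ j) {S : ℝ} (hS : 64 * (2 : ℝ) ^ j ≤ S) :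
    4 * (S + 1) ^ 2 * (2 : ℝ) ^ (2 * j + 1) * Real.exp (-(S / 2)) ≤ j * (S - 6 * j - 2) := by
  set X := (2 : ℝ) ^ j with hX
  have hX1 : 1 ≤ X := one_le_pow₀ (by norm_num)
  have hXj : (j : ℝ) ≤ X := by
    have := Nat.lt_two_pow_self (n := j)
    rw [hX]; exact_mod_cast this.le
  have hj1 : (1 : ℝ) ≤ j := by exact_mod_cast hj
  have hS64 : 64 ≤ S := by nlinarith
  have hS0 : 0 < S := by linarith
  -- `e^{−S/2}·S⁴ ≤ 384`
  have hexp : Real.exp (-(S / 2)) * S ^ 4 ≤ 384 := by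
    have h1 := Real.pow_div_factorial_le_exp (S / 2) (by positivity) 4
    have h4 : ((Nat.factorial 4 : ℕ) : ℝ) = 24 := by norm_num [Nat.factorial]
    rw [h4] at h1
    have h2 : (S / 2) ^ 4 / 24 = S ^ 4 / 384 := by ring
    rw [h2, div_le_iff₀ (by norm_num : (0 : ℝ) < 384)] at h1
    rw [Real.exp_neg]
    have hpos : 0 < Real.exp (S / 2) := Real.exp_pos _
    rw [inv_mul_le_iff₀ hpos]
    linarith
  -- `2^{2j+1} = 2·X²`
  have e1 : (2 : ℝ) ^ (2 * j + 1) = 2 * X ^ 2 := by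
    rw [hX, show 2 * j + 1 = j * 2 + 1 by ring, pow_succ, pow_mul]; ring
  rw [e1]
  -- left side ≤ 3
  have hS4 : 0 < S ^ 4 := by positivity
  have hL : 4 * (S + 1) ^ 2 * (2 * X ^ 2) * Real.exp (-(S / 2)) ≤ 3 := by
    -- multiply by `S⁴`: `8(S+1)²X²·(e^{−S/2}S⁴) ≤ 8·(2S)²·(S/64)²·384 = 3 S⁴`
    have hSX : X ≤ S / 64 := by linarith
    have hX0 : 0 ≤ X := by linarith
    have h1 : (S + 1) ^ 2 ≤ (2 * S) ^ 2 := by nlinarith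
    have h2 : X ^ 2 ≤ (S / 64) ^ 2 := pow_le_pow_left₀ hX0 hSX 2
    have hE0 : 0 ≤ Real.exp (-(S / 2)) := (Real.exp_pos _).le
    have h3 : 4 * (S + 1) ^ 2 * (2 * X ^ 2) * Real.exp (-(S / 2)) * S ^ 4 ≤ 3 * S ^ 4 := by
      calc 4 * (S + 1) ^ 2 * (2 * X ^ 2) * Real.exp (-(S / 2)) * S ^ 4
          = 8 * (S + 1) ^ 2 * X ^ 2 * (Real.exp (-(S / 2)) * S ^ 4) := by ring
        _ ≤ 8 * (2 * S) ^ 2 * (S / 64) ^ 2 * 384 := by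
            have ha : 8 * (S + 1) ^ 2 * X ^ 2 ≤ 8 * (2 * S) ^ 2 * (S / 64) ^ 2 := by nlinarith [sq_nonneg X, sq_nonneg S]
            have hb : 0 ≤ 8 * (S + 1) ^ 2 * X ^ 2 := by positivity
            calc 8 * (S + 1) ^ 2 * X ^ 2 * (Real.exp (-(S / 2)) * S ^ 4) ≤ 8 * (S + 1) ^ 2 * X ^ 2 * 384 :=
                  mul_le_mul_of_nonneg_left hexp hb
              _ ≤ 8 * (2 * S) ^ 2 * (S / 64) ^ 2 * 384 := mul_le_mul_of_nonneg_right ha (by norm_num)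
        _ = 3 * S ^ 4 := by ring
    exact le_of_mul_le_mul_right h3 hS4
  -- right side ≥ 3
  have hR : (3 : ℝ) ≤ j * (S - 6 * j - 2) := by
    have h1 : 56 ≤ S - 6 * j - 2 := by nlinarith
    nlinarith
  linarith

/-! ## LEMMA 1 at every layer (crude constants) -/

/-- **LEMMA 1 at layer `j ≥ 1`**: if `0 < h ≤ 1` on `range K`, `Σ_{k<K} h k ≥ 64·2^j` and `j·K < (Σ+1)²`, then `witGavg K h j ≥ 1`. [this work] -/
theorem witGavg_ge_one_largeK {h : ℕ → ℝ} (hh : ∀ k, k < K → 0 < h k ∧ h k ≤ 1) {j : ℕ} (hj : 1 ≤ j)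
    (hSig : 64 * (2 : ℝ) ^ j ≤ ∑ k ∈ range K, h k) (hjK : (j : ℝ) * K < (∑ k ∈ range K, h k + 1) ^ 2) :
    1 ≤ witGavg K h j := by
  have hh' : ∀ k, k < K → 0 ≤ h k ∧ h k ≤ 1 := fun k hk => ⟨(hh k hk).1.le, (hh k hk).2⟩
  set S := ∑ k ∈ range K, h k with hSdef
  have hj0 : (0 : ℝ) < j := by exact_mod_cast (show 0 < j by omega)
  have hnum := largeK_numeric hj hSig
  -- `P := P(T ≤ 2j+1) ≤ 2^{2j+1} e^{−S/2}`
  set P := ∑ Q ∈ (range K).powerset, hairW K h Q * (if (Q ∩ range K).card ≤ 2 * j + 1 then (1 : ℝ) else 0) with hPdef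
  have hP0 : 0 ≤ P := Finset.sum_nonneg fun Q _ => mul_nonneg (hairW_nonneg hh' Q) (by split_ifs <;> norm_num)
  have hPbound : P ≤ (2 : ℝ) ^ (2 * j + 1) * Real.exp (-(S / 2)) := by
    have hc := pow_mul_sum_hairW_count_le_exp hh' (range K) (2 * j + 1) (θ := 1 / 2) (by norm_num) (by norm_num)
    have hfilt : (range K).filter (fun k => k ∈ range K) = range K := by ext k; simp
    rw [hfilt, ← hSdef, ← hPdef] at hc
    have e : -(1 - 1 / 2) * S = -(S / 2) := by ring
    rw [e] at hc
    have h2 : (2 : ℝ) ^ (2 * j + 1) * ((1 / 2 : ℝ) ^ (2 * j + 1) * P) = P := by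
      rw [← mul_assoc, ← mul_pow]; norm_num
    calc P = (2 : ℝ) ^ (2 * j + 1) * ((1 / 2 : ℝ) ^ (2 * j + 1) * P) := h2.symm
      _ ≤ (2 : ℝ) ^ (2 * j + 1) * Real.exp (-(S / 2)) := mul_le_mul_of_nonneg_left hc (by positivity)
  -- hence `4 K P ≤ S − 6j − 2`
  have hK0 : (0 : ℝ) ≤ K := Nat.cast_nonneg K
  have h4KP : 4 * K * P ≤ S - 6 * j - 2 := by
    have h1 : 4 * K * P ≤ 4 * K * ((2 : ℝ) ^ (2 * j + 1) * Real.exp (-(S / 2))) :=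
      mul_le_mul_of_nonneg_left hPbound (by positivity)
    set B := (2 : ℝ) ^ (2 * j + 1) * Real.exp (-(S / 2)) with hBdef
    have hBpos : 0 ≤ B := by positivity
    have h2 : (j : ℝ) * (4 * K * B) ≤ 4 * (S + 1) ^ 2 * B := by
      have := mul_le_mul_of_nonneg_right hjK.le hBpos
      nlinarith
    have hnum' : 4 * (S + 1) ^ 2 * B ≤ j * (S - 6 * j - 2) := by
      have e : 4 * (S + 1) ^ 2 * B = 4 * (S + 1) ^ 2 * (2 : ℝ) ^ (2 * j + 1) * Real.exp (-(S / 2)) := by rw [hBdef]; ring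
      rw [e]; exact hnum
    have h1' : (j : ℝ) * (4 * K * P) ≤ j * (4 * K * B) := mul_le_mul_of_nonneg_left h1 hj0.le
    have h3 : (j : ℝ) * (4 * K * P) ≤ j * (S - 6 * j - 2) := h1'.trans (h2.trans hnum')
    exact le_of_mul_le_mul_left h3 hj0
  -- central positions (threshold `2j`)
  set Cen := (range K).filter (fun k => (2 * j : ℝ) ≤ ∑ i ∈ range k, h i ∧ (2 * j : ℝ) ≤ ∑ i ∈ (range K).filter (fun i => k < i), h i)
    with hCendef
  have hCen := card_central_gt_gen hh' (M := (2 * j : ℝ)) (by positivity)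
  rw [← hSdef, ← hCendef] at hCen
  -- the case `P = 0`: no deficit at all (mass = 1, boost ≥ 0)
  rcases eq_or_lt_of_le hP0 with hz | hPpos
  · rw [witGavg_eq_mass_add_boost (fun k hk => (hh k hk).1) j]
    have hmass : ∑ Q ∈ (range K).powerset, hairW K h Q * (if (wit j Q).Nonempty then (1 : ℝ) else 0) = 1 := by
      have hdef : ∑ Q ∈ (range K).powerset, hairW K h Q * (if (wit j Q).Nonempty then (0 : ℝ) else 1) ≤ P := by
        refine Finset.sum_le_sum fun Q hQ => mul_le_mul_of_nonneg_left ?_ (hairW_nonneg hh' Q)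
        rw [Finset.mem_powerset] at hQ
        split_ifs with h1 h2
        · norm_num
        · norm_num
        · norm_num
        · exfalso
          have := (Finset.card_le_card (Finset.inter_subset_left (s₁ := Q) (s₂ := range K))).trans (card_le_of_wit_not_nonempty h1)
          omega
      have hdef0 : 0 ≤ ∑ Q ∈ (range K).powerset, hairW K h Q * (if (wit j Q).Nonempty then (0 : ℝ) else 1) :=
        Finset.sum_nonneg fun Q _ => mul_nonneg (hairW_nonneg hh' Q) (by split_ifs <;> norm_num)
      have htot : ∑ Q ∈ (range K).powerset, hairW K h Q * (if (wit j Q).Nonempty then (1 : ℝ) else 0) +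
          ∑ Q ∈ (range K).powerset, hairW K h Q * (if (wit j Q).Nonempty then (0 : ℝ) else 1) = 1 := by
        rw [← Finset.sum_add_distrib]
        calc ∑ Q ∈ (range K).powerset, (hairW K h Q * (if (wit j Q).Nonempty then (1 : ℝ) else 0) +
                hairW K h Q * (if (wit j Q).Nonempty then (0 : ℝ) else 1))
            = ∑ Q ∈ (range K).powerset, hairW K h Q := Finset.sum_congr rfl fun Q _ => by split_ifs <;> ring
          _ = 1 := sum_hairW_eq_one h
      linarith
    have hboost : 0 ≤ ∑ k ∈ range K, ∑ Q ∈ ((range K).erase k).powerset, hairW K h Q * witAvgKernel j (insert k Q) k :=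
      Finset.sum_nonneg fun k _ => Finset.sum_nonneg fun Q _ => mul_nonneg (hairW_nonneg hh' Q) (by
        unfold witAvgKernel; split_ifs
        · exact div_nonneg zero_le_one (Nat.cast_nonneg _)
        · exact le_rfl)
    linarith
  -- the charging criterion with unit weights on `Cen` and `Ω₀ = 4 K P`
  have hKpos : (0 : ℝ) < K := by
    rcases Nat.eq_zero_or_pos K with hK0' | hK0'
    · exfalso
      rw [hK0'] at hSdef
      have : S = 0 := by rw [hSdef, Finset.range_zero, Finset.sum_empty]
      have : (64 : ℝ) * 2 ^ j ≤ 0 := by rw [← this]; exact hSig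
      have : (0 : ℝ) < 64 * 2 ^ j := by positivity
      linarith
    · exact_mod_cast hK0'
  have hΩ : 0 < 4 * K * P := by positivity
  refine witGavg_ge_one_of_charging hh j (fun k => if k ∈ Cen then 1 else 0) hΩ (fun H hH hne => ?_) (fun k hk => ?_)
  · -- cover: `4KP ≤ #(Cen ∖ H)`
    have hHc : H.card ≤ 2 * j := card_le_of_wit_not_nonempty hne
    have hsum : ∑ k ∈ range K \ H, (if k ∈ Cen then (1 : ℝ) else 0) = (((range K \ H).filter (fun k => k ∈ Cen)).card : ℝ) := by
      rw [Finset.sum_boole]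
    rw [hsum]
    have hsub : Cen \ H ⊆ (range K \ H).filter (fun k => k ∈ Cen) := by
      intro k hk
      rw [Finset.mem_sdiff] at hk
      exact Finset.mem_filter.2 ⟨Finset.mem_sdiff.2 ⟨(Finset.mem_filter.1 hk.1).1, hk.2⟩, hk.1⟩
    have hc1 : ((Cen \ H).card : ℝ) ≤ (((range K \ H).filter (fun k => k ∈ Cen)).card : ℝ) := by
      exact_mod_cast Finset.card_le_card hsub
    have hc2 : (Cen.card : ℝ) - 2 * j ≤ ((Cen \ H).card : ℝ) := by
      have h' : Cen.card - H.card ≤ (Cen \ H).card := Finset.le_card_sdiff H Cen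
      have h2j : (H.card : ℝ) ≤ 2 * j := by exact_mod_cast hHc
      have : (Cen.card : ℝ) - (H.card : ℝ) ≤ ((Cen.card - H.card : ℕ) : ℝ) := by
        rcases le_or_gt H.card Cen.card with hle | hgt
        · rw [Nat.cast_sub hle]
        · rw [Nat.sub_eq_zero_of_le hgt.le]; push_cast; linarith [(Nat.cast_lt (α := ℝ)).2 hgt]
      have h'' : ((Cen.card - H.card : ℕ) : ℝ) ≤ ((Cen \ H).card : ℝ) := by exact_mod_cast h'
      linarith
    linarith
  · -- comparison: `ω_k d_k ≤ 4KP · a_k`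
    have ha0 : 0 ≤ ∑ Q ∈ ((range K).erase k).powerset, hairW K h Q * witAvgKernel j (insert k Q) k :=
      Finset.sum_nonneg fun Q _ => mul_nonneg (hairW_nonneg hh' Q) (by
        unfold witAvgKernel; split_ifs
        · exact div_nonneg zero_le_one (Nat.cast_nonneg _)
        · exact le_rfl)
    by_cases hkC : k ∈ Cen
    · rw [if_pos hkC, one_mul]
      have hkC' := hkC
      rw [hCendef, Finset.mem_filter] at hkC'
      -- `d_k = (1 − h k)·D⁰_k ≤ (1 − h k)·P`
      have hd : ∑ Q ∈ ((range K).erase k).powerset, hairW K h Q * (if (wit j Q).Nonempty then (0 : ℝ) else 1) =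
          (1 - h k) * ∑ Q ∈ ((range K).erase k).powerset, hairW K (Function.update h k 0) Q * (if (wit j Q).Nonempty then (0 : ℝ) else 1) := by
        rw [Finset.mul_sum]
        refine Finset.sum_congr rfl fun Q hQ => ?_
        rw [Finset.mem_powerset] at hQ
        rw [hairW_eq_mul_erase h hk (fun hm => Finset.notMem_erase k _ (hQ hm))]
        ring
      have hPk := noWit_erase_le_gen hh' j hk
      rw [← hPdef] at hPk
      have ha := boost_ge_quarter_div hh' hj hk hkC'.2.1 hkC'.2.2
      have hu : 0 ≤ 1 - h k := by linarith [(hh k hk).2]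
      rw [hd]
      calc (1 - h k) * ∑ Q ∈ ((range K).erase k).powerset,
            hairW K (Function.update h k 0) Q * (if (wit j Q).Nonempty then (0 : ℝ) else 1)
          ≤ (1 - h k) * P := mul_le_mul_of_nonneg_left hPk hu
        _ = 4 * K * P * ((1 - h k) / (4 * K)) := by field_simp
        _ ≤ 4 * K * P * ∑ Q ∈ ((range K).erase k).powerset, hairW K h Q * witAvgKernel j (insert k Q) k :=
            mul_le_mul_of_nonneg_left ha hΩ.le
    · rw [if_neg hkC, zero_mul]
      exact mul_nonneg hΩ.le ha0

/-- **EVERY LAYER OF FAR ON ALL LONG HAIRY CYCLES.**  For every layer `j ≥ 2` and every hair count `K` with `(64·2^j + 2)² ≤ j·K`: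
`SunFAR K j` — FAR at layer `j` on the sun graph with `K` hairs, all cycle-edge and hair weights (hence, by
`HairyCycle.farRelayRow_hairyCycle_of_sunFAR`, on every hairy cycle with `K` pendant relays).  Unconditional. [this work] -/
theorem sunFAR_of_largeK {j : ℕ} (hj : 2 ≤ j) {K : ℕ} (hK : (64 * 2 ^ j + 2) ^ 2 ≤ j * K) : SunFAR K j := by
  have hj1 : 1 ≤ j := le_trans (by norm_num) hj
  -- `K ≥ 2`
  have hK2 : 2 ≤ K := by
    by_contra hlt
    have hK1 : K ≤ 1 := by omega
    have h1 : j * K ≤ j := by nlinarith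
    have h2 : j < 2 ^ j := Nat.lt_two_pow_self
    have h3 : 2 ^ j ≤ (64 * 2 ^ j + 2) ^ 2 := by nlinarith
    omega
  refine sunFAR_of_witGavg_from_all hj K hK2 (fun K' hK' h hh m hm hmin hS2j hR => ?_) K le_rfl
  -- truncate `h` outside `range K'`
  set h' : ℕ → ℝ := fun k => if k < K' then h k else 0 with hh'def
  have he : ∀ k, k < K' → h' k = h k := fun k hk => by rw [hh'def]; simp only [hk, if_true]
  have hh' : ∀ k, 0 ≤ h' k ∧ h' k ≤ 1 := by
    intro k
    by_cases hk : k < K'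
    · rw [he k hk]; exact hh k hk
    · rw [hh'def]; simp only [hk, if_false]; norm_num
  have hsum : ∑ k ∈ range K', h' k = ∑ k ∈ range K', h k :=
    Finset.sum_congr rfl fun k hk => he k (Finset.mem_range.1 hk)
  have hF : hairV K' h' j (range K') = hairV K' h j (range K') := hairV_congr he j (range K')
  -- LEMMA 2 for `h'`
  have hL2 := jK_lt_of_R (K := K') hh' hj1 hm (fun k hk => by rw [he m hm, he k hk]; exact hmin k hk)
    (by rw [hsum]; exact hS2j) (by rw [hsum, hF, he m hm]; exact hR)
  rw [hsum, he m hm] at hL2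
  obtain ⟨hjK, hηpos⟩ := hL2
  -- `Σ ≥ 64·2^j` from `(64·2^j+2)² ≤ jK ≤ jK' < (Σ+1)²`
  set S := ∑ k ∈ range K', h k with hSdef
  have hS0 : 0 ≤ S := Finset.sum_nonneg fun k hk => (hh k (Finset.mem_range.1 hk)).1
  have hbound : (64 * (2 : ℝ) ^ j + 2) ^ 2 < (S + 1) ^ 2 := by
    have h1 : ((64 * 2 ^ j + 2) ^ 2 : ℕ) ≤ j * K' := hK.trans (Nat.mul_le_mul_left j hK')
    have h2 : (((64 * 2 ^ j + 2) ^ 2 : ℕ) : ℝ) ≤ (j : ℝ) * K' := by exact_mod_cast h1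
    push_cast at h2
    linarith
  have hSig : 64 * (2 : ℝ) ^ j ≤ S := by
    have hlt : 64 * (2 : ℝ) ^ j + 2 < S + 1 := lt_of_pow_lt_pow_left₀ 2 (by linarith) hbound
    linarith
  -- all hairs alive
  have hhpos : ∀ k, k < K' → 0 < h k ∧ h k ≤ 1 := fun k hk => ⟨lt_of_lt_of_le hηpos (hmin k hk), (hh k hk).2⟩
  exact witGavg_ge_one_largeK hhpos hj1 hSig hjK

end HairyCycle

end Summit.CriticalPhenomena.PercolationContinuityZ3.Theorems

end
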